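import Literature.MathematicalPhysics.QuantumFieldTheory.Balaban1983to89.StrongCouplingKernelWindow
import Literature.Probability.LatticeModels.DobrushinComparisonDefectStates
import HarnessLib

/-!
# Venture YMGap — STATE-LIPSCHITZ: the strong-coupling DLR state of `SU(N)` lattice Yang–Mills is
# Lipschitz in the coupling (Kantorovich–Rubinstein form, explicit modulus), via Föllmer's comparison
# theorem WITH DEFECTS

HONEST FRAMING: venture file of the cell `pub-ymgap` (QuantumFields programme), seat ds-1.  Strong-coupling
LATTICE statements for `SU(N)` lattice Yang–Mills on `ℤ^d` with the Wilson action, inside the ONE-LINK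
Dobrushin window of the tree (`OneLinkKRModulus N R K`, `2(d−1)|β| ≤ R`, Dobrushin constant
`c = 6(d−1)|β|K < 1`, 't Hooft coupling `β`, bare coupling `N β`); a LIPSCHITZ statement (not `C¹`, not
analyticity); nothing about the continuum, confinement at weak coupling, or the Clay problem.

THE THEOREM (`abs_integral_sub_integral_le_of_oneLinkKRModulus`).  Let `μ` be a DLR state at 't Hooft
coupling `β` inside the window and `ν` a DLR state at ANY other coupling `β'` on the same radius
(`2(d−1)|β'| ≤ R`; no smallness of `β'` beyond that).  Then for every bounded measurable observable `f`
depending on the links of a finite set `Δ`, with link-wise Lipschitz vector `δ` for the Frobenius distance,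

  `|∫ f dμ − ∫ f dν| ≤ (2(d−1)√N · K · |β − β'| / (1 − c)) · Σ_{y ∈ Δ} δ_y`,

i.e. local expectations are LIPSCHITZ IN THE COUPLING on the window, with a modulus that does not see where
`Δ` sits; and the Lipschitz-cylinder form (`…_cylinder`, Shen–Zhu–Zhu's observable class, constant `· #Λ · K_F`).
The companion file `StateLipschitzRows` carries the MEAN-PLAQUETTE corollary (the kernel form of «no jump of the
internal energy inside the window») and the hypothesis-free rows (every `N ≥ 2` via the Bakry–Émery modulus;
`SU(2)`, `d = 4` via the quarter modulus).

MECHANISM (all inputs are tree theorems; this file is bookkeeping).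
(1) `abs_integral_sub_integral_le_of_gibbs_pair` — GENERIC: a specification `γ` under Dobrushin's condition in
the Vasserstein form (`IsKRContraction γ r nbr C`, row sums `≤ c < 1`), a Gibbs measure `μ` of `γ`, and a Gibbs
measure `ν` of ANOTHER specification `γ'` whose one-site laws are uniformly `b`-close to those of `γ` in the
Kantorovich–Rubinstein distance dual to `r`: then `|μ f − ν f| ≤ (b/(1−c)) Σ_Δ δ(f)`.  Proof: Föllmer's
Comparison Theorem (2.8) with defects at the measure level
(`Literature…DobrushinMetric.abs_integral_sub_integral_le_of_defect`): `ν` is a state whose DEFECT against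
`γ`'s one-site averaging is `≤ b δ_x(f)` — by the DLR equations FOR `γ'` (`ν(γ'_x f) = ν f`) the defect is
`|ν(γ_x f − γ'_x f)| ≤ sup_η |γ_x(·|η)(f(η^{x←·})) − γ'_x(·|η)(f(η^{x←·}))|` — and the constant vector
`d ≡ b/(1−c)` is a super-solution of `b + C d ≤ d`.
(2) `oneLink_coupling_defect` — for the 't Hooft-scaled Wilson specification the one-link laws at `β` and
`β'` are the tilted Haar laws `ν_{B}`, `ν_{B'}` with `B = β S_η`, `B' = β' S_η` (`siteLaw_ymSpecification_thooft`,
`S_η` the staple sum), so the SAME modulus `OneLinkKRModulus N R K` that drives the contraction bounds the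
defect: `‖B − B'‖_F = |β − β'| ‖S_η‖_F ≤ |β − β'| · 2(d−1)√N` (`frobNorm_stapleField_sub_stapleField_le`).
(3) The contraction side is VERBATIM the construction of the tree's door `dlrMassGap_of_oneLinkKRModulus`
(influence coefficients `K|β| n(x,y)`, row sums `≤ 6(d−1)|β|K`).

References (mechanism; nothing is cited as a named fact): H. Föllmer, *Random fields and diffusion processes*,
LNM 1362 (1988), Ch. I, Comparison Theorem (2.8) with Remark (2.17); R. L. Dobrushin, Theory Probab. Appl. 15
(1970) 458–486, §5 (continuity of the Gibbs state in the specification); H.-O. Georgii, *Gibbs Measures and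
Phase Transitions* (2011), Thm. 8.20 and Cor. 8.23–8.24 (the comparison theorem and continuous dependence on
the interaction); H. Shen, R. Zhu, X. Zhu, CMP 400 (2023) 805–851 (the one-link window).
-/

noncomputable section

open MeasureTheory Function Finset ProbabilityTheory
open scoped NNReal
open Literature.Probability.LatticeModels
open Literature.Probability.LatticeModels.DobrushinMetric
open Literature.MathematicalPhysics.QuantumLattice
open Literature.MathematicalPhysics.QuantumFieldTheory hiding ZdEdge
open Literature.MathematicalPhysics.QuantumFieldTheory.Balaban1983to89.StrongCouplingDobrushinWindow
open Literature.MathematicalPhysics.QuantumFieldTheory.Balaban1983to89.StrongCouplingKernelWindow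
  (oneLinkKRModulus_SU)

namespace Summit.Ventures.YMGap.StateLipschitz

/-! ## §1 Generic: two Gibbs measures of two specifications, one of them a Dobrushin contraction -/

section Generic

variable {V S : Type*} [MeasurableSpace S]

/-- **Comparison of the Gibbs states of two specifications** (Föllmer's Comparison Theorem (2.8) with defects,
specialised to a Gibbs measure of a second specification).  Let `γ` satisfy Dobrushin's condition in the
Vasserstein form with row sums `≤ c < 1` (weight `r`, `0 ≤ r ≤ R`), `μ` a Gibbs measure of `γ`, and `ν` a Gibbs
measure of another specification `γ'` whose one-site laws are `b`-close to those of `γ`, uniformly in the site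
and the boundary condition, in the Kantorovich–Rubinstein distance dual to `r` (tested on bounded measurable
`r`-Lipschitz `φ`).  Then for every bounded measurable `f` depending on `Δ` with Lipschitz vector `δ`:
`|∫ f dμ − ∫ f dν| ≤ (b / (1 − c)) · Σ_{y ∈ Δ} δ_y`.  The defect of `ν` against `γ_x` is controlled through the
DLR equations of `ν` for `γ'_x`; the constant vector `b/(1−c)` is a super-solution.
[cite: Follmer1988, Ch. I Comparison Theorem (2.8)] -/
theorem abs_integral_sub_integral_le_of_gibbs_pair [DecidableEq V] {γ γ' : Specification V S}
    (hγ : IsSpecification γ) (hγ' : IsSpecification γ') {r : S → S → ℝ} {nbr : V → Finset V}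
    {C : V → V → ℝ} (hC : IsKRContraction γ r nbr C) {R : ℝ} (hr0 : ∀ a b, 0 ≤ r a b)
    (hrR : ∀ a b, r a b ≤ R) (hR : 0 ≤ R) {c : ℝ} (hc0 : 0 ≤ c) (hc1 : c < 1)
    (hrow : ∀ x, ∑ y ∈ nbr x, C x y ≤ c) {μ : Measure (V → S)} (hμ : IsGibbsMeasure γ μ)
    {ν : Measure (V → S)} (hν : IsGibbsMeasure γ' ν) {b : ℝ} (hb : 0 ≤ b)
    (hker : ∀ (x : V) (η : V → S) (φ : S → ℝ) (L : ℝ), Measurable φ → (∃ M, ∀ s, |φ s| ≤ M) →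
      0 ≤ L → (∀ a a', |φ a - φ a'| ≤ L * r a a') →
      |∫ s, φ s ∂(siteLaw γ x η) - ∫ s, φ s ∂(siteLaw γ' x η)| ≤ b * L)
    {f : (V → S) → ℝ} (hfm : Measurable f) {Δ : Finset V} (hfdep : DependsOn f (↑Δ : Set V))
    {M : ℝ} (hM : ∀ σ, |f σ| ≤ M) {δ : V → ℝ} (hδ : IsLipBound r f δ) :
    |(∫ σ, f σ ∂μ) - ∫ σ, f σ ∂ν| ≤ b / (1 - c) * ∑ y ∈ Δ, δ y := by
  haveI := hν.isProbabilityMeasure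
  have h1c : 0 < 1 - c := sub_pos.2 hc1
  set D : ℝ := b / (1 - c) with hD
  have hD0 : 0 ≤ D := div_nonneg hb h1c.le
  -- the defect of `ν` against the one-site averaging of `γ`
  have hdef : ∀ (x : V) (g : (V → S) → ℝ) (Δ' : Finset V) (δ' : V → ℝ), Measurable g →
      DependsOn g (↑Δ' : Set V) → (∃ M, ∀ σ, |g σ| ≤ M) → IsLipBound r g δ' →
        |(∫ σ, siteAvg γ x g σ ∂ν) - ∫ σ, g σ ∂ν| ≤ (fun _ : V => b) x * δ' x := by
    intro x g Δ' δ' hgm _ hgb hgδ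
    obtain ⟨Mg, hMg⟩ := hgb
    have hDLR : ∫ σ, siteAvg γ' x g σ ∂ν = ∫ σ, g σ ∂ν :=
      hν.integral_integral_eq hγ' {x} (integrable_of_abs_le' hgm hMg)
    have hi₁ : Integrable (siteAvg γ x g) ν :=
      integrable_of_abs_le' (measurable_siteAvg hγ x hgm) (abs_siteAvg_le hγ x hMg)
    have hi₂ : Integrable (siteAvg γ' x g) ν :=
      integrable_of_abs_le' (measurable_siteAvg hγ' x hgm) (abs_siteAvg_le hγ' x hMg)
    rw [← hDLR, ← integral_sub hi₁ hi₂]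
    have hpt : ∀ σ, |siteAvg γ x g σ - siteAvg γ' x g σ| ≤ b * δ' x := by
      intro σ
      rw [siteAvg_eq_integral_siteLaw hγ x hgm σ, siteAvg_eq_integral_siteLaw hγ' x hgm σ]
      refine hker x σ (fun s => g (Function.update σ x s)) (δ' x) (hgm.comp (measurable_update σ))
        ⟨Mg, fun s => hMg _⟩ (hgδ.nonneg x) fun a a' => ?_
      have h := hgδ.le x (Function.update σ x a) (Function.update σ x a')
        (fun z hz => by rw [Function.update_of_ne hz, Function.update_of_ne hz])
      simpa using h
    calc |∫ σ, (siteAvg γ x g σ - siteAvg γ' x g σ) ∂ν|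
        ≤ ∫ σ, |siteAvg γ x g σ - siteAvg γ' x g σ| ∂ν := abs_integral_le_integral_abs
      _ ≤ ∫ _σ, b * δ' x ∂ν :=
          integral_mono (hi₁.sub hi₂).abs (integrable_const _) hpt
      _ = b * δ' x := by simp
  have hsuper : ∀ x, (fun _ : V => b) x + (∑ y ∈ nbr x, C x y * (fun _ : V => D) y) ≤ (fun _ : V => D) x := by
    intro x
    have hsum : ∑ y ∈ nbr x, C x y * D = (∑ y ∈ nbr x, C x y) * D := by rw [Finset.sum_mul]
    have hle : (∑ y ∈ nbr x, C x y) * D ≤ c * D := mul_le_mul_of_nonneg_right (hrow x) hD0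
    have hfix : b + c * D = D := by
      rw [hD]
      field_simp
      ring
    simp only [hsum]
    linarith
  have key := abs_integral_sub_integral_le_of_defect hγ hC hr0 hrR hR hc0 hc1 hrow hμ (ν := ν)
    (b := fun _ => b) (fun _ => hb) hdef (d := fun _ => D) (fun _ => hD0) hsuper hfm hfdep hM hδ
  calc |(∫ σ, f σ ∂μ) - ∫ σ, f σ ∂ν| ≤ ∑ y ∈ Δ, D * δ y := key
    _ = D * ∑ y ∈ Δ, δ y := by rw [Finset.mul_sum]

end Generic

/-! ## §2 `SU(N)` lattice Yang–Mills on `ℤ^d`: the coupling direction -/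

section YM

variable {d N : ℕ}

/-- `‖S_ω‖_F ≤ #{p ∋ x} · √N` for the staple sum at a link (each staple is special unitary, of Frobenius
norm `√N`). [folklore] -/
theorem frobNorm_stapleSum_le (x : ZdEdge d) (ω : LGConfig d (Matrix.specialUnitaryGroup (Fin N) ℂ)) :
    frobNorm (stapleSum x ω) ≤ (plaquettesTouching {x}).card * Real.sqrt N := by
  classical
  unfold stapleSum
  refine (frobNorm_sum_le _ _).trans ?_
  rw [Finset.sum_congr rfl fun p _ => frobNorm_su _, Finset.sum_const, nsmul_eq_mul]

/-- **The link field is `2(d−1)√N`-Lipschitz in the 't Hooft coupling, in Frobenius norm**: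
`‖B_ω(β) − B_ω(β')‖_F = |β − β'| ‖S_ω‖_F ≤ |β − β'| · 2(d−1)√N`. [folklore] -/
theorem frobNorm_stapleField_sub_stapleField_le (hd : 1 ≤ d) (β β' : ℝ) (x : ZdEdge d)
    (ω : LGConfig d (Matrix.specialUnitaryGroup (Fin N) ℂ)) :
    frobNorm (stapleField β x ω - stapleField β' x ω) ≤
      |β - β'| * (2 * ((d : ℝ) - 1) * Real.sqrt N) := by
  classical
  rw [stapleField, stapleField, ← sub_smul, ← Complex.ofReal_sub, frobNorm_smul, Complex.norm_real,
    Real.norm_eq_abs]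
  refine mul_le_mul_of_nonneg_left ((frobNorm_stapleSum_le x ω).trans ?_) (abs_nonneg _)
  refine mul_le_mul_of_nonneg_right ?_ (Real.sqrt_nonneg _)
  calc ((plaquettesTouching {x}).card : ℝ) ≤ ((2 * (d - 1) : ℕ) : ℝ) := by
        exact_mod_cast card_plaquettesTouching_singleton_le x
    _ = 2 * ((d : ℝ) - 1) := by push_cast [Nat.cast_sub hd]; ring

/-- **One-link defect in the coupling.**  Under `OneLinkKRModulus N R K` and `2(d−1)|β|, 2(d−1)|β'| ≤ R`, the
one-link conditional laws of the 't Hooft-scaled Wilson specification at `β` and at `β'`, with the SAME exterior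
`η`, are within Kantorovich–Rubinstein distance `K · 2(d−1)√N · |β − β'|` (dual to the Frobenius distance):
they are the tilted Haar laws `ν_{β S_η}`, `ν_{β' S_η}` and the modulus applies. [folklore] -/
theorem oneLink_coupling_defect (hd : 1 ≤ d) (hN : 1 ≤ N) {β β' R K : ℝ} (hK : 0 ≤ K)
    (hR : |β| * (2 * ((d : ℝ) - 1)) ≤ R) (hR' : |β'| * (2 * ((d : ℝ) - 1)) ≤ R)
    (hmod : OneLinkKRModulus N R K) (x : ZdEdge d)
    (η : LGConfig d (Matrix.specialUnitaryGroup (Fin N) ℂ))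
    (φ : Matrix.specialUnitaryGroup (Fin N) ℂ → ℝ) (L : ℝ) (hφm : Measurable φ)
    (hφb : ∃ M, ∀ s, |φ s| ≤ M) (hL : 0 ≤ L) (hφL : ∀ a b, |φ a - φ b| ≤ L * suFrobDist a b) :
    |∫ s, φ s ∂(siteLaw (ymSpecification (fundamentalRep (Fin N)) (N * β)) x η) -
        ∫ s, φ s ∂(siteLaw (ymSpecification (fundamentalRep (Fin N)) (N * β')) x η)| ≤
      K * (2 * ((d : ℝ) - 1) * Real.sqrt N) * |β - β'| * L := by
  classical
  rw [siteLaw_ymSpecification_thooft β x η, siteLaw_ymSpecification_thooft β' x η]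
  have hB : matrixOpNorm (stapleField β x η) ≤ R := (matrixOpNorm_stapleField_le hd hN β x η).trans hR
  have hB' : matrixOpNorm (stapleField β' x η) ≤ R :=
    (matrixOpNorm_stapleField_le hd hN β' x η).trans hR'
  refine (hmod _ _ hB hB' φ L hφm hφb hL hφL).trans ?_
  calc K * L * frobNorm (stapleField β x η - stapleField β' x η)
      ≤ K * L * (|β - β'| * (2 * ((d : ℝ) - 1) * Real.sqrt N)) :=
        mul_le_mul_of_nonneg_left (frobNorm_stapleField_sub_stapleField_le hd β β' x η) (mul_nonneg hK hL)
    _ = K * (2 * ((d : ℝ) - 1) * Real.sqrt N) * |β - β'| * L := by ring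

/-- **STATE-LIPSCHITZ — the strong-coupling DLR state is Lipschitz in the coupling.**  `SU(N)` lattice
Yang–Mills on `ℤ^d` (`d ≥ 2`, `N ≥ 2`), 't Hooft couplings `β, β'` with `2(d−1)|β|, 2(d−1)|β'| ≤ R`, a one-link
modulus `OneLinkKRModulus N R K` (`K ≥ 0`) and the Dobrushin constant `c = 6(d−1)|β|K < 1` AT `β` (nothing is
asked of `β'` beyond the radius).  Then for every DLR state `μ` at `β`, every DLR state `ν` at `β'`, and every
bounded measurable `f` depending on the finite link set `Δ` with Frobenius-Lipschitz vector `δ`: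
`|∫ f dμ − ∫ f dν| ≤ (K · 2(d−1)√N · |β − β'| / (1 − c)) · Σ_{y ∈ Δ} δ_y`.
[cite: Follmer1988, Ch. I Comparison Theorem (2.8)] -/
theorem abs_integral_sub_integral_le_of_oneLinkKRModulus (hd : 2 ≤ d) (hN : 2 ≤ N) {β β' R K : ℝ}
    (hK : 0 ≤ K) (hR : |β| * (2 * ((d : ℝ) - 1)) ≤ R) (hR' : |β'| * (2 * ((d : ℝ) - 1)) ≤ R)
    (hmod : OneLinkKRModulus N R K) (hsmall : 6 * ((d : ℝ) - 1) * |β| * K < 1)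
    {μ ν : Measure (LGConfig d (Matrix.specialUnitaryGroup (Fin N) ℂ))}
    (hμ : μ ∈ ymGibbsMeasures (d := d) (fundamentalRep (Fin N)) (N * β))
    (hν : ν ∈ ymGibbsMeasures (d := d) (fundamentalRep (Fin N)) (N * β'))
    {f : LGConfig d (Matrix.specialUnitaryGroup (Fin N) ℂ) → ℝ} (hfm : Measurable f)
    {Δ : Finset (ZdEdge d)} (hfdep : DependsOn f (↑Δ : Set (ZdEdge d))) {M : ℝ} (hM : ∀ σ, |f σ| ≤ M)
    {δ : ZdEdge d → ℝ} (hδ : IsLipBound suFrobDist f δ) :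
    |(∫ σ, f σ ∂μ) - ∫ σ, f σ ∂ν| ≤
      K * (2 * ((d : ℝ) - 1) * Real.sqrt N) * |β - β'| / (1 - 6 * ((d : ℝ) - 1) * |β| * K) *
        ∑ y ∈ Δ, δ y := by
  classical
  -- `SU(N) ⊆ M_N(ℂ)` is second countable
  haveI : SecondCountableTopology (Matrix (Fin N) (Fin N) ℂ) :=
    inferInstanceAs (SecondCountableTopology (Fin N → Fin N → ℂ))
  haveI : SecondCountableTopology (Matrix.specialUnitaryGroup (Fin N) ℂ) :=
    Topology.IsEmbedding.subtypeVal.secondCountableTopology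
  have hd2 : (2 : ℝ) ≤ d := by exact_mod_cast hd
  have hd0 : (0 : ℝ) < (d : ℝ) - 1 := by linarith
  have hd1' : 1 ≤ d := by omega
  have hN1 : 1 ≤ N := by omega
  set c : ℝ := 6 * ((d : ℝ) - 1) * |β| * K with hc
  have hc0 : 0 ≤ c := by positivity
  set C : ZdEdge d → ZdEdge d → ℝ := fun x y => K * |β| * linkInfluence x y with hCdef
  have hC0 : ∀ x y, 0 ≤ C x y := fun x y => by positivity
  -- row sums of the influence coefficients (verbatim `dlrMassGap_of_oneLinkKRModulus`)
  have hrow : ∀ x, ∑ y ∈ linkPlaqNbr x, C x y ≤ c := by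
    intro x
    simp only [hCdef]
    rw [← Finset.mul_sum]
    have hsum : ∑ y ∈ linkPlaqNbr x, (linkInfluence x y : ℝ) ≤ 6 * ((d : ℝ) - 1) := by
      have h := sum_linkInfluence_le (d := d) x
      calc ∑ y ∈ linkPlaqNbr x, (linkInfluence x y : ℝ)
          = ((∑ y ∈ linkPlaqNbr x, linkInfluence x y : ℕ) : ℝ) := by push_cast; rfl
        _ ≤ ((6 * (d - 1) : ℕ) : ℝ) := by exact_mod_cast h
        _ = 6 * ((d : ℝ) - 1) := by push_cast [Nat.cast_sub hd1']; ring
    calc K * |β| * ∑ y ∈ linkPlaqNbr x, (linkInfluence x y : ℝ) ≤ K * |β| * (6 * ((d : ℝ) - 1)) :=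
          mul_le_mul_of_nonneg_left hsum (by positivity)
      _ = c := by rw [hc]; ring
  -- the one-link Kantorovich–Rubinstein contraction from the modulus (verbatim the tree's door)
  have hcontr : ∀ (x : ZdEdge d), ∀ y ∈ linkPlaqNbr x,
      ∀ (ω η : LGConfig d (Matrix.specialUnitaryGroup (Fin N) ℂ)),
      (∀ z, z ≠ y → ω z = η z) →
      ∀ (φ : Matrix.specialUnitaryGroup (Fin N) ℂ → ℝ) (L : ℝ), Measurable φ →
        (∃ M, ∀ s, |φ s| ≤ M) → 0 ≤ L → (∀ a b, |φ a - φ b| ≤ L * suFrobDist a b) →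
        |∫ s, φ s ∂(siteLaw (ymSpecification (fundamentalRep (Fin N)) (N * β)) x ω) -
            ∫ s, φ s ∂(siteLaw (ymSpecification (fundamentalRep (Fin N)) (N * β)) x η)| ≤
          C x y * L * suFrobDist (ω y) (η y) := by
    intro x y _ ω η hωη φ L hφm hφb hL hφL
    rw [siteLaw_ymSpecification_thooft β x ω, siteLaw_ymSpecification_thooft β x η]
    have hBω : matrixOpNorm (stapleField β x ω) ≤ R := (matrixOpNorm_stapleField_le hd1' hN1 β x ω).trans hR
    have hBη : matrixOpNorm (stapleField β x η) ≤ R := (matrixOpNorm_stapleField_le hd1' hN1 β x η).trans hR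
    have key := hmod _ _ hBω hBη φ L hφm hφb hL hφL
    refine key.trans ?_
    have hdiff := frobNorm_stapleField_sub_le β x y hωη
    calc K * L * frobNorm (stapleField β x ω - stapleField β x η)
        ≤ K * L * (|β| * linkInfluence x y * suFrobDist (ω y) (η y)) :=
          mul_le_mul_of_nonneg_left hdiff (mul_nonneg hK hL)
      _ = C x y * L * suFrobDist (ω y) (η y) := by simp only [hCdef]; ring
  have hγ : IsSpecification (ymSpecification (d := d) (fundamentalRep (Fin N)) (N * β)) :=
    isSpecification_ymSpecification_of_t2Space _ (continuous_fundamentalRep (Fin N)) _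
  have hγ' : IsSpecification (ymSpecification (d := d) (fundamentalRep (Fin N)) (N * β')) :=
    isSpecification_ymSpecification_of_t2Space _ (continuous_fundamentalRep (Fin N)) _
  have hKR : IsKRContraction (ymSpecification (d := d) (fundamentalRep (Fin N)) (N * β)) suFrobDist
      linkPlaqNbr C :=
    isKRContraction_ymSpecification _ (continuous_fundamentalRep (Fin N)) _ hC0 hcontr
  have hR₀ : (0 : ℝ) ≤ 2 * Real.sqrt N := by positivity
  have hμ' : IsGibbsMeasure (ymSpecification (d := d) (fundamentalRep (Fin N)) (N * β)) μ := hμ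
  have hν' : IsGibbsMeasure (ymSpecification (d := d) (fundamentalRep (Fin N)) (N * β')) ν := hν
  -- the uniform one-link defect in the coupling
  set b : ℝ := K * (2 * ((d : ℝ) - 1) * Real.sqrt N) * |β - β'| with hb
  have hb0 : 0 ≤ b := by positivity
  have hker : ∀ (x : ZdEdge d) (η : LGConfig d (Matrix.specialUnitaryGroup (Fin N) ℂ))
      (φ : Matrix.specialUnitaryGroup (Fin N) ℂ → ℝ) (L : ℝ), Measurable φ → (∃ M, ∀ s, |φ s| ≤ M) →
      0 ≤ L → (∀ a a', |φ a - φ a'| ≤ L * suFrobDist a a') →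
      |∫ s, φ s ∂(siteLaw (ymSpecification (fundamentalRep (Fin N)) (N * β)) x η) -
          ∫ s, φ s ∂(siteLaw (ymSpecification (fundamentalRep (Fin N)) (N * β')) x η)| ≤ b * L :=
    fun x η φ L hφm hφb hL hφL => by
      simpa only [hb] using oneLink_coupling_defect hd1' hN1 hK hR hR' hmod x η φ L hφm hφb hL hφL
  have key := abs_integral_sub_integral_le_of_gibbs_pair hγ hγ' hKR suFrobDist_nonneg suFrobDist_le hR₀
    hc0 hsmall hrow hμ' hν' hb0 hker hfm hfdep hM hδ
  simpa only [hb, hc] using key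

/-- **Lipschitz-cylinder form** (Shen–Zhu–Zhu's observable class): for a Lipschitz cylinder function `F` with
support `Λ` and constant `K_F` (entry metric), `|∫ F dμ − ∫ F dν| ≤ (K · 2(d−1)√N · |β − β'| / (1 − c)) · #Λ · K_F`.
[cite: Follmer1988, Ch. I Comparison Theorem (2.8)] -/
theorem abs_integral_sub_integral_le_of_oneLinkKRModulus_cylinder (hd : 2 ≤ d) (hN : 2 ≤ N)
    {β β' R K : ℝ} (hK : 0 ≤ K) (hR : |β| * (2 * ((d : ℝ) - 1)) ≤ R)
    (hR' : |β'| * (2 * ((d : ℝ) - 1)) ≤ R) (hmod : OneLinkKRModulus N R K)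
    (hsmall : 6 * ((d : ℝ) - 1) * |β| * K < 1)
    {μ ν : Measure (LGConfig d (Matrix.specialUnitaryGroup (Fin N) ℂ))}
    (hμ : μ ∈ ymGibbsMeasures (d := d) (fundamentalRep (Fin N)) (N * β))
    (hν : ν ∈ ymGibbsMeasures (d := d) (fundamentalRep (Fin N)) (N * β'))
    {F : LGConfig d (Matrix.specialUnitaryGroup (Fin N) ℂ) → ℝ} {Λ : Finset (ZdEdge d)} {KF : ℝ≥0}
    (hF : IsLipschitzCylinder (fundamentalRep (Fin N)) F Λ KF) :
    |(∫ σ, F σ ∂μ) - ∫ σ, F σ ∂ν| ≤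
      K * (2 * ((d : ℝ) - 1) * Real.sqrt N) * |β - β'| / (1 - 6 * ((d : ℝ) - 1) * |β| * K) *
        (Λ.card * KF) := by
  classical
  have hA : ∀ a b : Matrix.specialUnitaryGroup (Fin N) ℂ,
      dist (suEntries a) (suEntries b) ≤ 1 * suFrobDist a b :=
    fun a b => by rw [one_mul]; exact dist_suEntries_le_suFrobDist a b
  have key := abs_integral_sub_integral_le_of_oneLinkKRModulus hd hN hK hR hR' hmod hsmall hμ hν
    hF.measurable hF.dependsOn hF.abs_le (hF.isLipBound zero_le_one hA)
  have hsum : ∑ y ∈ Λ, (if y ∈ Λ then (1 : ℝ) * (KF : ℝ) else 0) = Λ.card * KF := by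
    rw [Finset.sum_ite_of_true (fun y hy => hy), Finset.sum_const, nsmul_eq_mul, one_mul]
  rw [hsum] at key
  exact key

end YM

end Summit.Ventures.YMGap.StateLipschitz

end
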